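import Mathlib
import Summits.ValiantsHypothesis.ValiantsHypothesis.Theses.ValuativeGCT
import Summits.ValiantsHypothesis.ValiantsHypothesis.Theorems.ValuativeGCTValuativeFlipStabInvLeExplicit
import Summits.ValiantsHypothesis.ValiantsHypothesis.Theorems.ValuativeGCTValuativeFlipSliceBound
import Summits.ValiantsHypothesis.ValiantsHypothesis.Theorems.ValuativeGCTValuativeFlipTangentRank
import Summits.ValiantsHypothesis.ValiantsHypothesis.Theorems.ValuativeGCTValuativeFlipHilbertLowerBound
import Summits.ValiantsHypothesis.ValiantsHypothesis.Theorems.ValuativeGCTValuativeFlipMultiplicityCount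
import Summits.ValiantsHypothesis.ValiantsHypothesis.Theorems.ValuativeGCTValuativeFlipGrowthGap
import Summits.ValiantsHypothesis.ValiantsHypothesis.Theorems.ValuativeGCTValuativeFlipBottomBridge

/-!
# `ValuativeGCT.ValuativeFlip` (stmt-ValiantsHypothesis-12624) — the registered bottom stub of line
# `per-anchor-catch-up` (`stub_bottomFlip`: `m = n`, `U = ⊥`, `r = 0`) from the landed bottom of line `skew-restriction-rank`

What is proved: `perAnchor_bottomFlip` — for every `n ≥ 3` there are a degree `δ` and a shape `λ ⊢ nδ` with at
most `n²` parts such that the crux's valuative truncation at the NO-CUT centre `U = ⊥`, `r = 0`,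
`T_⊥(λ) = Hom_{nδ}(ℂ[End W]) ∩ (vanishing ideal of L_⊥)^{δ(n-0)} ∩ (Stab_End(det_n)-invariants) ∩ HWV_{λ*}`,
has dimension strictly below `mult_{λ*} ℂ[Δ_n(per_n)] = orbitMultiplicity ℂ (paddedPerFormLex ℂ n n) n λ*`.
This is the body of the crux `ValuativeGCT.ValuativeFlip` at the bottom `m = n` of every window with the centre
FIXED (not existential), i.e. the per-anchor line's `stub_bottomFlip` with its two `let`s inlined.

Mechanism: the proof of `bottomCensusFlip` / `valuativeFlip_bottom` (file `ValuativeGCTValuativeFlipBottomWindow`,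
line `skew-restriction-rank`), replayed here directly from the six landed bottom-of-the-window stubs so that this
file depends only on them: B1 `stub_sliceBound` (the det side restricts injectively to a Krylov slice of
dimension `z = n⁴-2n²+2n`, so `dim (Hom_{nδ} ∩ sandInv) ≤ (nδ+1)^z`), B2 `stub_tangentRank` and B3
`stub_hilbertLowerBound` (the per side contains `C(δ+N, N)` independent products, `N+1 = n⁴-n²`), B5
`stub_growthGap` (`z+1 ≤ N` for `n ≥ 3`, so some `δ` flips the totals), B4 `stub_multiplicityCount` and B6
`stub_bottomBridge` (complete reducibility + highest weights turn the total gap into a multiplicity gap at a crux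
weight `λ* = (dualOfPartition (n·n) λ).toMatIdx`, `λ ⊢ nδ`); this gives
`dim (Hom_{nδ} ∩ sandInv ∩ trInv ∩ HWV_{λ*}) < mult_{λ*}`.  Finally `stub_stabInv_le_explicit` (`T_⊥ ≤ E`: abstract
`Stab_End(det_n)`-invariants are invariant under the row-wise unimodular sandwiches and the row-wise transpose)
together with `Hom_{nδ} ∩ I ≤ Hom_{nδ}` bounds the truncation by that explicit census space
(`Submodule.finrank_mono` inside the finite-dimensional `Hom_{nδ}`).  Sources: Mulmuley–Sohoni 2001 §4–5;
BLMW 2011 §5.2; Marcus–May 1962 / Botta 1967 for `dim Stab(per_n) = 2n - 2` (background only).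
-/

set_option linter.dupNamespace false

namespace Summit.ValiantsHypothesis.ValiantsHypothesis.Theorems.ValuativeFlip

open scoped BigOperators Matrix
open Literature.NumberTheory.DiophantineGeometry
open Literature.Computability.AlgebraicComplexity

noncomputable section

/-- **The bottom of every window is free** — the registered stub `stub_bottomFlip` of line
`per-anchor-catch-up` (`Cruxes/ValuativeFlip/Lines/per-anchor-catch-up.lean`) with its two `let`s inlined (ζ-reduced) and
named arguments written as type ascriptions (definitionally the same statement; `exact perAnchor_bottomFlip` closes that stub): for `n ≥ 3` there are `δ` and `λ ⊢ nδ`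
(`≤ n²` parts) such that the crux's truncation at the no-cut centre `U = ⊥`, `r = 0` has dimension `< P_n(λ) =
mult_{λ*} ℂ[Δ_n(per_n)]`.  From `bottomCensusFlip` (B1–B6) and `stub_stabInv_le_explicit`. [Mulmuley–Sohoni 2001 §4–5; BLMW 2011 §5.2; this line] -/
theorem perAnchor_bottomFlip :
    ∀ (n : ℕ) [NeZero n], 3 ≤ n → ∃ (δ : ℕ) (lam : Nat.Partition (n * δ)), lam.parts.card ≤ n * n ∧
      Module.finrank ℂ ↥(MvPolynomial.homogeneousSubmodule (MatIdx n × MatIdx n) ℂ (n * δ) ⊓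
        ((MvPolynomial.vanishingIdeal ℂ {p : MatIdx n × MatIdx n → ℂ | ∀ j : MatIdx n, (fun i => p (j, i)) ∈ (⊥ : Submodule ℂ (MatIdx n → ℂ))}) ^ (δ * (n - 0))).restrictScalars ℂ ⊓
        (⨅ (M : Matrix (MatIdx n) (MatIdx n) ℂ) (_ : linSubst (MatIdx n) ℂ M (detFormLex ℂ n) = detFormLex ℂ n), LinearMap.ker ((MvPolynomial.aeval fun p : MatIdx n × MatIdx n => ∑ l : MatIdx n, M l p.2 • (MvPolynomial.X (p.1, l) : MvPolynomial (MatIdx n × MatIdx n) ℂ)).toLinearMap - (LinearMap.id : MvPolynomial (MatIdx n × MatIdx n) ℂ →ₗ[ℂ] MvPolynomial (MatIdx n × MatIdx n) ℂ))) ⊓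
        (⨅ (g : Matrix.GeneralLinearGroup (MatIdx n) ℂ) (_ : IsUpperTriangular g), LinearMap.ker ((MvPolynomial.aeval fun p : MatIdx n × MatIdx n => ∑ l : MatIdx n, ((g⁻¹ : Matrix.GeneralLinearGroup (MatIdx n) ℂ) : Matrix (MatIdx n) (MatIdx n) ℂ) p.1 l • (MvPolynomial.X (l, p.2) : MvPolynomial (MatIdx n × MatIdx n) ℂ)).toLinearMap - weightChar ((Weight.dualOfPartition (n * n) lam).toMatIdx : Weight (MatIdx n)) g • (LinearMap.id : MvPolynomial (MatIdx n × MatIdx n) ℂ →ₗ[ℂ] MvPolynomial (MatIdx n × MatIdx n) ℂ)))) <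
        orbitMultiplicity ℂ (paddedPerFormLex ℂ n n) n ((Weight.dualOfPartition (n * n) lam).toMatIdx : Weight (MatIdx n)) := by
  intro n _ hn
  -- adapted from `bottomCensusFlip` / `valuativeFlip_bottom` (Theorems/ValuativeGCTValuativeFlipBottomWindow)
  obtain ⟨hpp0, htan⟩ := stub_tangentRank n hn
  -- exponent arithmetic: `2n² ≤ n⁴` and `z + 1 ≤ N`
  have h2sq : 2 * n ^ 2 ≤ n ^ 4 := by
    have h2 : 2 ≤ n ^ 2 := by nlinarith
    calc 2 * n ^ 2 ≤ n ^ 2 * n ^ 2 := Nat.mul_le_mul_right _ h2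
      _ = n ^ 4 := by ring
  have hzN : (n ^ 4 - 2 * n ^ 2 + 2 * n) + 1 ≤ n ^ 4 - n ^ 2 - 1 := by
    have h1 : 2 * n + 3 ≤ n ^ 2 := by nlinarith
    revert h1 h2sq
    generalize n ^ 4 = A
    generalize n ^ 2 = B
    intro h2sq h1
    omega
  obtain ⟨δ, hδ⟩ := stub_growthGap n (n ^ 4 - 2 * n ^ 2 + 2 * n) (n ^ 4 - n ^ 2 - 1) hzN
  have hN : (n ^ 4 - n ^ 2 - 1) + 1 ≤ Module.finrank ℂ ↥(Submodule.span ℂ (Set.range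
      fun ab : MatIdx n × MatIdx n =>
        MvPolynomial.X ab.1 * MvPolynomial.pderiv ab.2 (paddedPerFormLex ℂ n n))) := by
    have h1 : 1 ≤ n ^ 2 := Nat.one_le_pow _ _ (by omega)
    revert htan h2sq h1
    generalize n ^ 4 = A
    generalize n ^ 2 = B
    intro htan h2sq h1
    omega
  have h3 := stub_hilbertLowerBound (MatIdx n) (paddedPerFormLex ℂ n n) n
    (paddedPerFormLex_isHomogeneous ℂ le_rfl) hpp0 (n ^ 4 - n ^ 2 - 1) δ hN
  have h1 := stub_sliceBound n (by omega) (n * δ)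
  -- `Hom_{nδ}` is finite-dimensional, hence so is everything below it
  haveI hfinHom : Module.Finite ℂ ↥(MvPolynomial.homogeneousSubmodule (MatIdx n × MatIdx n) ℂ (n * δ)) :=
    Module.Finite.iff_fg.mpr (MvPolynomial.homogeneousSubmodule_fg (MatIdx n × MatIdx n) ℂ (n * δ))
  have hfin : Module.Finite ℂ ↥(MvPolynomial.homogeneousSubmodule (MatIdx n × MatIdx n) ℂ (n * δ) ⊓
      (⨅ (P : Matrix (Fin n) (Fin n) ℂ) (Q : Matrix (Fin n) (Fin n) ℂ) (_ : P.det = 1) (_ : Q.det = 1),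
              LinearMap.ker ((MvPolynomial.aeval fun p : MatIdx n × MatIdx n =>
                  ∑ l : MatIdx n, (P (ofLex p.2).1 (ofLex l).1 * Q (ofLex l).2 (ofLex p.2).2) •
                    (MvPolynomial.X (p.1, l) : MvPolynomial (MatIdx n × MatIdx n) ℂ)).toLinearMap -
                (LinearMap.id : MvPolynomial (MatIdx n × MatIdx n) ℂ →ₗ[ℂ] MvPolynomial (MatIdx n × MatIdx n) ℂ)))) :=
    Submodule.finiteDimensional_of_le inf_le_left
  have hmono : Module.finrank ℂ ↥(MvPolynomial.homogeneousSubmodule (MatIdx n × MatIdx n) ℂ (n * δ) ⊓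
        ((⨅ (P : Matrix (Fin n) (Fin n) ℂ) (Q : Matrix (Fin n) (Fin n) ℂ) (_ : P.det = 1) (_ : Q.det = 1),
              LinearMap.ker ((MvPolynomial.aeval fun p : MatIdx n × MatIdx n =>
                  ∑ l : MatIdx n, (P (ofLex p.2).1 (ofLex l).1 * Q (ofLex l).2 (ofLex p.2).2) •
                    (MvPolynomial.X (p.1, l) : MvPolynomial (MatIdx n × MatIdx n) ℂ)).toLinearMap -
                (LinearMap.id : MvPolynomial (MatIdx n × MatIdx n) ℂ →ₗ[ℂ] MvPolynomial (MatIdx n × MatIdx n) ℂ))) ⊓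
          LinearMap.ker ((MvPolynomial.aeval fun p : MatIdx n × MatIdx n =>
                (MvPolynomial.X (p.1, toLex ((ofLex p.2).2, (ofLex p.2).1)) :
                  MvPolynomial (MatIdx n × MatIdx n) ℂ)).toLinearMap -
              (LinearMap.id : MvPolynomial (MatIdx n × MatIdx n) ℂ →ₗ[ℂ] MvPolynomial (MatIdx n × MatIdx n) ℂ)))) ≤
      Module.finrank ℂ ↥(MvPolynomial.homogeneousSubmodule (MatIdx n × MatIdx n) ℂ (n * δ) ⊓
        (⨅ (P : Matrix (Fin n) (Fin n) ℂ) (Q : Matrix (Fin n) (Fin n) ℂ) (_ : P.det = 1) (_ : Q.det = 1),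
              LinearMap.ker ((MvPolynomial.aeval fun p : MatIdx n × MatIdx n =>
                  ∑ l : MatIdx n, (P (ofLex p.2).1 (ofLex l).1 * Q (ofLex l).2 (ofLex p.2).2) •
                    (MvPolynomial.X (p.1, l) : MvPolynomial (MatIdx n × MatIdx n) ℂ)).toLinearMap -
                (LinearMap.id : MvPolynomial (MatIdx n × MatIdx n) ℂ →ₗ[ℂ] MvPolynomial (MatIdx n × MatIdx n) ℂ)))) :=
    Submodule.finrank_mono (inf_le_inf_left _ inf_le_left)
  have hgap := lt_of_le_of_lt (hmono.trans h1) (lt_of_lt_of_le hδ h3)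
  obtain ⟨lam, hcard, hlt⟩ := stub_bottomBridge stub_multiplicityCount n δ hgap
  refine ⟨δ, lam, hcard, ?_⟩
  -- `T_⊥ ≤ E`: drop the vanishing-ideal factor, bound the abstract stabiliser factor by `sandInv ⊓ trInv`
  exact lt_of_le_of_lt (Submodule.finrank_mono (inf_le_inf (le_inf (inf_le_left.trans inf_le_left)
    (inf_le_right.trans (stub_stabInv_le_explicit n))) le_rfl)) hlt

end

end Summit.ValiantsHypothesis.ValiantsHypothesis.Theorems.ValuativeFlip
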